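import Summits.KontsevichZagierPeriods.KontsevichZagierPeriods.Theses.FermatIsogeny
import Summits.KontsevichZagierPeriods.KontsevichZagierPeriods.Theorems.FermatIsogenyBetaLinearSectorHalfIntegers
import Summits.KontsevichZagierPeriods.KontsevichZagierPeriods.Theorems.TorsionLogsOneThirdPeriod
import Summits.KontsevichZagierPeriods.KontsevichZagierPeriods.Theorems.IsogenyCertificatesXMapKernelStubSectorRepsExist
import Literature.NumberTheory.Transcendental.EllIterRep
import Summits.KontsevichZagierPeriods.KontsevichZagierPeriods.Theorems.FermatIsogenyBetaLinearSectorSixthsStubIsogenyNeg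
import Summits.KontsevichZagierPeriods.KontsevichZagierPeriods.Theorems.FermatIsogenyBetaLinearSectorSixthsStubIsogenyMid
import Summits.KontsevichZagierPeriods.KontsevichZagierPeriods.Theorems.FermatIsogenyBetaLinearSectorSixthsStubIsogenyPos
import Summits.KontsevichZagierPeriods.KontsevichZagierPeriods.Theorems.FermatIsogenyBetaLinearSectorSixthsStubSixthBetaTail
import Summits.KontsevichZagierPeriods.KontsevichZagierPeriods.Theorems.FermatIsogenyBetaLinearSectorSixthsStubCubicArcBeta

/-!
# `BetaLinearSector` at level `6` — the CM BRIDGE `B(1/6,1/2) = √3·B(1/3,1/2)` inside the calculus (a real `3`-isogeny as moves)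

Support file of crux `BetaLinearSector` (stmt-KontsevichZagierPeriods-3897, route FermatIsogeny).  At level `6` the Koblitz–Rohrlich class
`ℚ̄·Γ(1/3)³/π` contains the two Beta cells `β(1/6,1/2)` and `β(1/3,1/2)` (sixths `(1,3)` and `(2,3)`), whose values differ by the
ALGEBRAIC factor `√3` — a complex-multiplication coincidence (`y² = x³ + 1` has CM by `ℤ[ζ₃]`), not a translation, reflection or
duplication.  This file realises it by Kontsevich–Zagier moves (registered anchor `pinned_sixthHalf_equivalent_sqrt3_thirdHalf`):

* `B(1/6,1/2) = 3∫₁^∞ dX/√(X³−1)` by ONE substitution `x = X⁻³` (`stub_sixthBeta_equivalent_cubicTail`);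
* THE `3`-ISOGENY `ψ : E : y² = x³+1 → E′ : Y² = X³−1`, `ψ(x,y) = ((x³+4)/(3x²), y(x³−8)/(3√3x³))` (Vélu's isogeny with kernel the
  rational `3`-torsion `{O, (0,±1)}`, onto `y² = x³ − 27`, rescaled by `3√3`): `ψ^*(dX/Y) = √3·dx/y`, and its `x`-map is a bijection onto
  `(1,∞)` on each of the three arcs `(−1,0)`, `(0,2)`, `(2,∞)` of `E(ℝ)` (a `3 : 1` cover of the real circle), so
  `[(-1,∞), √3/√(x³+1)] ∼ 3·[(1,∞), 1/√(X³−1)]` — rule (1a) at the algebraic abscissae `0`, `2` (null points dropped) and three rule-(2)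
  moves (`stub_isogenyThree_piece_neg/_mid/_pos`);
* the torsion third of the real period, LANDED (`TorsionLogs.OneThirdPeriod.transfer`: `[(-1,0), 3/√(x³+1)] ∼ [(-1,∞), 1/√(x³+1)]`), and
  `3∫_{-1}^0 dx/√(x³+1) = B(1/3,1/2)` by ONE substitution `u = −x³` (`stub_cubicArc_equivalent_thirdBeta`).

Hence `[β(1/6,1/2)] ∼ [(1,∞), 3/√(X³−1)] ∼ [(-1,∞), √3/√(x³+1)] ∼ √3·[(-1,0), 3/√(x³+1)] ∼ [√3·β(1/3,1/2)]`: the first CM-isogeny coincidence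
of Beta values realised inside the calculus in this programme.  The half-line representations come from the landed
`SectorRepsExist.stub_sectorRepsExist` (`[{x³ + Ax + B > 0}, a/√(x³+Ax+B)]`).
References: M. Kontsevich, D. Zagier, *Periods* (2001), §1.2; J. Vélu, *Isogénies entre courbes elliptiques*, C. R. Acad. Sci. 273 (1971);
B. Gross, D. Rohrlich, *Some results on the Mordell–Weil group of the Jacobian of the Fermat curve*, Invent. Math. 44 (1978), §1.
-/

noncomputable section

namespace Summit.KontsevichZagierPeriods.FermatIsogeny.BetaLinearSector.Sixths

open MeasureTheory Set Literature.NumberTheory.Transcendental Literature.NumberTheory.Transcendental.KZ HalfIntegers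
open Literature.ModelTheory.ExponentialFields (IsSemialgebraic isSemialgebraic_setOf_eval_pos isSemialgebraic_setOf_eval_eq_zero
  isSemialgebraic_setOf_eval_nonneg)
open MvPolynomial (X C)
open Summit.KontsevichZagierPeriods.IsogenyCertificates.XMapKernelStubs.SectorRepsExist (stub_sectorRepsExist)
open Summit.KontsevichZagierPeriods.IsogenyCertificates.XMapPeriodTransferValue (cube_add_one_pos_iff)

set_option quotPrecheck false in
/-- `r` is PINNED as `[(0,1), c · t^{a-1}(1-t)^{b-1}]` (the two hypotheses on each representation in the crux, with a constant). -/
local notation "Pinned⟦" c ", " a ", " b ", " r "⟧" =>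
  (IntegralRep.domain r = {x : Fin 1 → ℝ | x 0 ∈ Set.Ioo (0:ℝ) 1} ∧
    Set.EqOn (IntegralRep.integrand r) (fun x : Fin 1 → ℝ => (c : ℝ) * (x 0) ^ (((a : ℚ) : ℝ) - 1) * (1 - x 0) ^ (((b : ℚ) : ℝ) - 1))
      (IntegralRep.domain r))

/-! ## The half-line representations on `y² = x³ ± 1` -/

/-- `[(-1,∞), a/√(x³+1)]` exists for every rational `a` (sector representation of `x³ + 1`, `Δ ≠ 0`). [cite: KontsevichZagier2001, §1.1] -/
theorem exists_cubicPlusRep (a : ℚ) : ∃ S : IntegralRep 1, S.domain = {x : Fin 1 → ℝ | -1 < x 0} ∧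
    S.integrand = fun x => (a : ℝ) / Real.sqrt (x 0 ^ 3 + 1) := by
  obtain ⟨S₀, hd, hi⟩ := stub_sectorRepsExist 0 1 a (by norm_num)
  have hset : S₀.domain = {x : Fin 1 → ℝ | -1 < x 0} := by
    rw [hd]
    ext x
    simp only [mem_setOf_eq, Int.cast_zero, zero_mul, add_zero, Int.cast_one]
    exact cube_add_one_pos_iff (x 0)
  have hint : S₀.integrand = fun x => (a : ℝ) / Real.sqrt (x 0 ^ 3 + 1) := by
    rw [hi]
    funext x
    simp
  refine ⟨⟨{x | -1 < x 0}, S₀.integrand, hset ▸ S₀.isSemialgebraic_domain, hset ▸ S₀.isSemialgebraicFunOn_integrand,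
    hset ▸ S₀.integrableOn⟩, rfl, hint⟩

/-- `x³ − 1 > 0 ↔ x > 1` (`x³ − 1 = (x − 1)(x² + x + 1)`, the second factor positive). [folklore] -/
theorem cube_sub_one_pos_iff (t : ℝ) : 0 < t ^ 3 - 1 ↔ 1 < t := by
  have hq : 0 < t ^ 2 + t + 1 := by nlinarith [sq_nonneg (t + 1 / 2)]
  rw [show t ^ 3 - 1 = (t - 1) * (t ^ 2 + t + 1) by ring, mul_pos_iff_of_pos_right hq, sub_pos]

/-- `[(1,∞), a/√(X³−1)]` exists for every rational `a` (sector representation of `X³ − 1`, `Δ ≠ 0`). [cite: KontsevichZagier2001, §1.1] -/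
theorem exists_cubicMinusRep (a : ℚ) : ∃ T : IntegralRep 1, T.domain = {x : Fin 1 → ℝ | 1 < x 0} ∧
    T.integrand = fun x => (a : ℝ) / Real.sqrt (x 0 ^ 3 - 1) := by
  obtain ⟨T₀, hd, hi⟩ := stub_sectorRepsExist 0 (-1) a (by norm_num)
  have hset : T₀.domain = {x : Fin 1 → ℝ | 1 < x 0} := by
    rw [hd]
    ext x
    simp only [mem_setOf_eq, Int.cast_zero, zero_mul, add_zero, Int.cast_neg, Int.cast_one, ← sub_eq_add_neg]
    exact cube_sub_one_pos_iff (x 0)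
  have hint : T₀.integrand = fun x => (a : ℝ) / Real.sqrt (x 0 ^ 3 - 1) := by
    rw [hi]
    funext x
    simp [sub_eq_add_neg]
  refine ⟨⟨{x | 1 < x 0}, T₀.integrand, hset ▸ T₀.isSemialgebraic_domain, hset ▸ T₀.isSemialgebraicFunOn_integrand,
    hset ▸ T₀.integrableOn⟩, rfl, hint⟩

/-! ## The `3`-isogeny as moves: `[(-1,∞), √3/√(x³+1)] ∼ [(1,∞), 3/√(X³−1)]` -/

/-- **The `3`-isogeny `y² = x³+1 → Y² = X³−1` inside the rules**: for `S = [(-1,∞), √3/√(x³+1)]` and `T₃ = [(1,∞), 3/√(X³−1)]`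
(integrands prescribed on the domains), `KZ.Equivalent S T₃` — rule (1a) at `x = 0` and `x = 2` (the points are null relations), the three
rule-(2) moves of the arcs onto `(1,∞)` along `X = (x³+4)/(3x²)`, and rule (1b) `3/√ = 1/√ + 1/√ + 1/√`. [cite: KontsevichZagier2001, §1.2] -/
theorem isogenyThree_transfer (S T₃ : IntegralRep 1) (hSd : S.domain = {x | -1 < x 0})
    (hSi : EqOn S.integrand (fun x => Real.sqrt 3 / Real.sqrt (x 0 ^ 3 + 1)) S.domain)
    (hTd : T₃.domain = {x | 1 < x 0}) (hTi : EqOn T₃.integrand (fun x => 3 / Real.sqrt (x 0 ^ 3 - 1)) T₃.domain) :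
    KZ.Equivalent S T₃ := by
  obtain ⟨T, hTd', hTi'⟩ := exists_cubicMinusRep 1
  -- the pieces of `(−1, ∞) ⊆ ℝ¹`
  set A : Set (Fin 1 → ℝ) := {p | -1 < p 0 ∧ p 0 < 0} with hA_def
  set R : Set (Fin 1 → ℝ) := {p | 0 ≤ p 0} with hR_def
  set Z : Set (Fin 1 → ℝ) := {p | p 0 = 0} with hZ_def
  set M : Set (Fin 1 → ℝ) := {p | 0 < p 0 ∧ p 0 < 2} with hM_def
  set R₂ : Set (Fin 1 → ℝ) := {p | 2 ≤ p 0} with hR₂_def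
  set Z₂ : Set (Fin 1 → ℝ) := {p | p 0 = 2} with hZ₂_def
  set P : Set (Fin 1 → ℝ) := {p | 2 < p 0} with hP_def
  set Cp : Set (Fin 1 → ℝ) := {p | 0 < p 0} with hCp_def
  have h2 : IsAlgebraic ℚ (2:ℝ) := by simpa using isAlgebraic_nat (R := ℚ) (A := ℝ) 2
  have hm1 : IsAlgebraic ℚ (-1:ℝ) := by simpa using isAlgebraic_int (R := ℚ) (A := ℝ) (-1)
  have hA : IsSemialgebraic ℚ A :=
    (KZ.isSemialgebraic_setOf_const_lt_apply hm1 0).inter (KZ.isSemialgebraic_setOf_apply_lt_const isAlgebraic_zero 0)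
  have hR : IsSemialgebraic ℚ R := by simpa using isSemialgebraic_setOf_eval_nonneg (k := ℚ) (R := ℝ) (X 0 : MvPolynomial (Fin 1) ℚ)
  have hZ : IsSemialgebraic ℚ Z := by simpa using isSemialgebraic_setOf_eval_eq_zero (k := ℚ) (R := ℝ) (X 0 : MvPolynomial (Fin 1) ℚ)
  have hCp : IsSemialgebraic ℚ Cp := KZ.isSemialgebraic_setOf_const_lt_apply isAlgebraic_zero 0
  have hM : IsSemialgebraic ℚ M := hCp.inter (KZ.isSemialgebraic_setOf_apply_lt_const h2 0)
  have hP : IsSemialgebraic ℚ P := KZ.isSemialgebraic_setOf_const_lt_apply h2 0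
  have hlt2 : IsSemialgebraic ℚ {p : Fin 1 → ℝ | p 0 < 2} := KZ.isSemialgebraic_setOf_apply_lt_const h2 0
  have hR₂ : IsSemialgebraic ℚ R₂ := by
    have h := hlt2.compl
    have he : {p : Fin 1 → ℝ | p 0 < 2}ᶜ = R₂ := by
      ext p
      simp [hR₂_def, not_lt]
    rwa [he] at h
  have hZ₂ : IsSemialgebraic ℚ Z₂ := by
    have h := hlt2.compl.inter hP.compl
    have he : {p : Fin 1 → ℝ | p 0 < 2}ᶜ ∩ Pᶜ = Z₂ := by
      ext p
      simp only [hP_def, hZ₂_def, mem_inter_iff, mem_compl_iff, mem_setOf_eq, not_lt]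
      constructor
      · rintro ⟨h1, h2⟩
        exact le_antisymm h2 h1
      · intro h
        rw [h]
        exact ⟨le_rfl, le_rfl⟩
    rwa [he] at h
  have hAsub : A ⊆ S.domain := fun p hp => by rw [hSd]; exact hp.1
  have hRsub : R ⊆ S.domain := fun p hp => by rw [hSd]; show -1 < p 0; linarith [show 0 ≤ p 0 from hp]
  have hZsub : Z ⊆ S.domain := fun p hp => by rw [hSd]; show -1 < p 0; linarith [show p 0 = 0 from hp]
  have hCpsub : Cp ⊆ S.domain := fun p hp => by rw [hSd]; show -1 < p 0; linarith [show 0 < p 0 from hp]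
  have hMsub : M ⊆ S.domain := fun p hp => hCpsub hp.1
  have hR₂sub : R₂ ⊆ S.domain := fun p hp => by rw [hSd]; show -1 < p 0; linarith [show 2 ≤ p 0 from hp]
  have hZ₂sub : Z₂ ⊆ S.domain := fun p hp => by rw [hSd]; show -1 < p 0; linarith [show p 0 = 2 from hp]
  have hPsub : P ⊆ S.domain := fun p hp => by rw [hSd]; show -1 < p 0; linarith [show 2 < p 0 from hp]
  set rA := S.restrict A hA hAsub
  set rR := S.restrict R hR hRsub
  set rZ := S.restrict Z hZ hZsub
  set rCp := S.restrict Cp hCp hCpsub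
  set rM := S.restrict M hM hMsub
  set rR₂ := S.restrict R₂ hR₂ hR₂sub
  set rZ₂ := S.restrict Z₂ hZ₂ hZ₂sub
  set rP := S.restrict P hP hPsub
  -- null points
  have hZnull : volume Z = 0 := KZ.volume_setOf_last_eq_zero (n := 0) 0
  have hZ₂null : volume Z₂ = 0 := KZ.volume_setOf_last_eq_zero (n := 0) 2
  -- rule 1a four times
  have m1 : KZ.of S - KZ.of rA - KZ.of rR ∈ KZ.domainAddRel := by
    refine ⟨1, S, rA, rR, ?_, ?_, fun _ _ => rfl, fun _ _ => rfl, rfl⟩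
    · show S.domain = A ∪ R
      rw [hSd]
      ext p
      simp only [mem_setOf_eq, mem_union, hA_def, hR_def]
      constructor
      · intro h
        rcases lt_or_ge (p 0) 0 with h' | h'
        · exact Or.inl ⟨h, h'⟩
        · exact Or.inr h'
      · rintro (h | h)
        · exact h.1
        · linarith
    · show volume (A ∩ R) = 0
      have he : A ∩ R = ∅ := eq_empty_of_forall_notMem fun p hp => (not_lt.mpr (show 0 ≤ p 0 from hp.2)) hp.1.2
      rw [he, measure_empty]
  have m2 : KZ.of rR - KZ.of rZ - KZ.of rCp ∈ KZ.domainAddRel := by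
    refine ⟨1, rR, rZ, rCp, ?_, ?_, fun _ _ => rfl, fun _ _ => rfl, rfl⟩
    · show R = Z ∪ Cp
      ext p
      simp only [mem_setOf_eq, mem_union, hR_def, hZ_def, hCp_def]
      constructor
      · intro h
        rcases (show 0 ≤ p 0 from h).lt_or_eq with h' | h'
        · exact Or.inr h'
        · exact Or.inl h'.symm
      · rintro (h | h)
        · exact le_of_eq h.symm
        · exact le_of_lt h
    · show volume (Z ∩ Cp) = 0
      exact measure_mono_null inter_subset_left hZnull
  have m3 : KZ.of rCp - KZ.of rM - KZ.of rR₂ ∈ KZ.domainAddRel := by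
    refine ⟨1, rCp, rM, rR₂, ?_, ?_, fun _ _ => rfl, fun _ _ => rfl, rfl⟩
    · show Cp = M ∪ R₂
      ext p
      simp only [mem_setOf_eq, mem_union, hCp_def, hM_def, hR₂_def]
      constructor
      · intro h
        rcases lt_or_ge (p 0) 2 with h' | h'
        · exact Or.inl ⟨h, h'⟩
        · exact Or.inr h'
      · rintro (h | h)
        · exact h.1
        · linarith
    · show volume (M ∩ R₂) = 0
      have he : M ∩ R₂ = ∅ := eq_empty_of_forall_notMem fun p hp => (not_lt.mpr (show 2 ≤ p 0 from hp.2)) hp.1.2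
      rw [he, measure_empty]
  have m4 : KZ.of rR₂ - KZ.of rZ₂ - KZ.of rP ∈ KZ.domainAddRel := by
    refine ⟨1, rR₂, rZ₂, rP, ?_, ?_, fun _ _ => rfl, fun _ _ => rfl, rfl⟩
    · show R₂ = Z₂ ∪ P
      ext p
      simp only [mem_setOf_eq, mem_union, hR₂_def, hZ₂_def, hP_def]
      constructor
      · intro h
        rcases (show 2 ≤ p 0 from h).lt_or_eq with h' | h'
        · exact Or.inr h'
        · exact Or.inl h'.symm
      · rintro (h | h)
        · exact le_of_eq h.symm
        · exact le_of_lt h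
    · show volume (Z₂ ∩ P) = 0
      exact measure_mono_null inter_subset_left hZ₂null
  have n1 : KZ.of rZ ∈ KZ.relations := KZ.of_mem_relations_of_volume_eq_zero rZ hZnull
  have n2 : KZ.of rZ₂ ∈ KZ.relations := KZ.of_mem_relations_of_volume_eq_zero rZ₂ hZ₂null
  -- the three isogeny moves
  have hSi' : ∀ {Q : Set (Fin 1 → ℝ)} (hQ : IsSemialgebraic ℚ Q) (hQs : Q ⊆ S.domain),
      EqOn (S.restrict Q hQ hQs).integrand (fun x => Real.sqrt 3 / Real.sqrt (x 0 ^ 3 + 1)) (S.restrict Q hQ hQs).domain :=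
    fun hQ hQs x hx => hSi (hQs hx)
  have eA : Equivalent rA T := stub_isogenyThree_piece_neg rA T rfl (hSi' hA hAsub) hTd' (fun x _ => by rw [hTi']; simp)
  have eM : Equivalent rM T := stub_isogenyThree_piece_mid rM T rfl (hSi' hM hMsub) hTd' (fun x _ => by rw [hTi']; simp)
  have eP : Equivalent rP T := stub_isogenyThree_piece_pos rP T rfl (hSi' hP hPsub) hTd' (fun x _ => by rw [hTi']; simp)
  -- rule 1b: `3/√ = 2/√ + 1/√`, `2/√ = 1/√ + 1/√`
  have h2alg : IsAlgebraic ℚ (2:ℝ) := h2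
  have m5 : KZ.of T₃ - KZ.of (T.constMul 2 h2alg) - KZ.of T ∈ KZ.integrandAddRel := by
    refine ⟨1, T₃, T.constMul 2 h2alg, T, by rw [IntegralRep.domain_constMul, hTd', hTd], by rw [hTd', hTd], fun x hx => ?_, rfl⟩
    have hx' : x ∈ T.domain := by rw [hTd']; rw [hTd] at hx; exact hx
    simp only [Pi.add_apply, IntegralRep.integrand_constMul, hTi hx, hTi']
    simp only [Rat.cast_one]
    ring
  have m6 : KZ.of (T.constMul 2 h2alg) - KZ.of T - KZ.of T ∈ KZ.integrandAddRel := by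
    refine ⟨1, T.constMul 2 h2alg, T, T, rfl, rfl, fun x _ => ?_, rfl⟩
    simp only [Pi.add_apply, IntegralRep.integrand_constMul]
    ring
  -- compose
  have h1 := KZ.domainAddRel_subset_relations m1
  have h2' := KZ.domainAddRel_subset_relations m2
  have h3 := KZ.domainAddRel_subset_relations m3
  have h4 := KZ.domainAddRel_subset_relations m4
  have h5 := KZ.integrandAddRel_subset_relations m5
  have h6 := KZ.integrandAddRel_subset_relations m6
  show KZ.of S - KZ.of T₃ ∈ KZ.relations
  have : KZ.of S - KZ.of T₃ = (KZ.of S - KZ.of rA - KZ.of rR) + (KZ.of rR - KZ.of rZ - KZ.of rCp) +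
      (KZ.of rCp - KZ.of rM - KZ.of rR₂) + (KZ.of rR₂ - KZ.of rZ₂ - KZ.of rP) + KZ.of rZ + KZ.of rZ₂ +
      (KZ.of rA - KZ.of T) + (KZ.of rM - KZ.of T) + (KZ.of rP - KZ.of T) -
      (KZ.of T₃ - KZ.of (T.constMul 2 h2alg) - KZ.of T) - (KZ.of (T.constMul 2 h2alg) - KZ.of T - KZ.of T) := by
    abel
  rw [this]
  exact KZ.relations.sub_mem (KZ.relations.sub_mem (KZ.relations.add_mem (KZ.relations.add_mem (KZ.relations.add_mem
    (KZ.relations.add_mem (KZ.relations.add_mem (KZ.relations.add_mem (KZ.relations.add_mem (KZ.relations.add_mem h1 h2') h3) h4)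
    n1) n2) eA) eM) eP) h5) h6

/-! ## The bridge -/

/-- **`B(1/6,1/2) = √3·B(1/3,1/2)` INSIDE THE CALCULUS** (registered anchor `pinned_sixthHalf_equivalent_sqrt3_thirdHalf`): every Beta cell pinned
as `[β(1/6,1/2)]` is KZ-equivalent to every cell pinned as `[√3·β(1/3,1/2)]` — through the tail `[(1,∞), 3/√(X³−1)]`, the `3`-isogeny
`y² = x³+1 → Y² = X³−1`, the torsion third of the real period (`OneThirdPeriod.transfer`) and the arc `[(-1,0), 3/√(x³+1)]`.
[cite: KontsevichZagier2001, §1.2] [cite: Gross1978, §1] -/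
theorem pinned_sixthHalf_equivalent_sqrt3_thirdHalf : ∀ (r d : KZ.IntegralRep 1), r.domain = {x | x 0 ∈ Set.Ioo (0:ℝ) 1} →
    Set.EqOn r.integrand (fun x => (x 0) ^ ((((1/6 : ℚ)) : ℝ) - 1) * (1 - x 0) ^ ((((1/2 : ℚ)) : ℝ) - 1)) r.domain →
    d.domain = {x | x 0 ∈ Set.Ioo (0:ℝ) 1} →
    Set.EqOn d.integrand (fun x => Real.sqrt 3 * (x 0) ^ ((((1/3 : ℚ)) : ℝ) - 1) * (1 - x 0) ^ ((((1/2 : ℚ)) : ℝ) - 1)) d.domain →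
    KZ.Equivalent r d := by
  intro r d hrd hri hdd hdi
  have hs3 : Real.sqrt 3 ^ 2 = 3 := Real.sq_sqrt (by norm_num)
  have h3 : IsAlgebraic ℚ (Real.sqrt 3) := by
    refine ⟨Polynomial.X ^ 2 - Polynomial.C 3, Polynomial.X_pow_sub_C_ne_zero (by norm_num) 3, ?_⟩
    simp [hs3]
  obtain ⟨T₃, hT₃d, hT₃i⟩ := exists_cubicMinusRep 3
  obtain ⟨S₁, hS₁d, hS₁i⟩ := exists_cubicPlusRep 1
  -- `r ∼ [(1,∞), 3/√(X³−1)]`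
  have e₁ : Equivalent r T₃ := by
    refine stub_sixthBeta_equivalent_cubicTail r T₃ hrd (fun x hx => ?_) hT₃d (fun x _ => by rw [hT₃i]; push_cast; rfl)
    rw [hri hx]
    norm_num
  -- `[(1,∞), 3/√(X³−1)] ∼ [(-1,∞), √3/√(x³+1)] = √3·S₁`
  have e₂ : Equivalent (S₁.constMul (Real.sqrt 3) h3) T₃ := by
    refine isogenyThree_transfer _ T₃ (by rw [IntegralRep.domain_constMul, hS₁d]) (fun x _ => ?_) hT₃d
      (fun x _ => by rw [hT₃i]; push_cast; rfl)
    simp only [IntegralRep.integrand_constMul, hS₁i, Rat.cast_one]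
    ring
  -- `S₁ ∼ [(-1,0), 3/√(x³+1)]` (OneThirdPeriod) `∼ β(1/3,1/2)`
  obtain ⟨A₃, hA₃d, hA₃i⟩ : ∃ A₃ : IntegralRep 1, A₃.domain = {x | -1 < x 0 ∧ x 0 < 0} ∧
      A₃.integrand = fun x => ((3:ℚ) : ℝ) / Real.sqrt (x 0 ^ 3 + 1) := by
    obtain ⟨S₃, hS₃d, hS₃i⟩ := exists_cubicPlusRep 3
    have hm1 : IsAlgebraic ℚ (-1:ℝ) := by simpa using isAlgebraic_int (R := ℚ) (A := ℝ) (-1)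
    have hA : IsSemialgebraic ℚ {x : Fin 1 → ℝ | -1 < x 0 ∧ x 0 < 0} :=
      (KZ.isSemialgebraic_setOf_const_lt_apply hm1 0).inter (KZ.isSemialgebraic_setOf_apply_lt_const isAlgebraic_zero 0)
    have hsub : {x : Fin 1 → ℝ | -1 < x 0 ∧ x 0 < 0} ⊆ S₃.domain := fun p hp => by rw [hS₃d]; exact hp.1
    exact ⟨S₃.restrict _ hA hsub, rfl, by rw [IntegralRep.integrand_restrict, hS₃i]⟩
  have e₃ : Equivalent A₃ S₁ :=
    Summit.KontsevichZagierPeriods.TorsionLogs.OneThirdPeriod.transfer A₃ S₁ (by rw [hA₃d]; rfl)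
      (fun x _ => by rw [hA₃i]; push_cast; rfl) hS₁d (fun x _ => by rw [hS₁i]; push_cast; rfl)
  obtain ⟨β, hβ⟩ := exists_pinned 1 isAlgebraic_one (by norm_num : (0:ℚ) < 1/3) (by norm_num : (0:ℚ) < 1/2)
  have e₄ : Equivalent A₃ β := by
    refine stub_cubicArc_equivalent_thirdBeta A₃ β hA₃d (fun x _ => by rw [hA₃i]; push_cast; rfl) hβ.1 (fun x hx => ?_)
    rw [hβ.2 hx]
    norm_num
  have e₅ : Equivalent d (β.constMul (Real.sqrt 3) h3) := equivalent_constMul_of_pinned h3 ⟨hdd, hdi⟩ hβ (mul_one _).symm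
  -- compose: r ∼ T₃ ∼ √3·S₁ ∼ √3·A₃ ∼ √3·β ∼ d
  exact e₁.trans (e₂.symm.trans (((e₃.symm.trans e₄).constMul (Real.sqrt 3) h3).trans e₅.symm))

end Summit.KontsevichZagierPeriods.FermatIsogeny.BetaLinearSector.Sixths

end
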